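import Mathlib.Combinatorics.SimpleGraph.Metric
import Literature.Computability.AlgebraicComplexity.FlipGraphStdStrassenBall
import Literature.Computability.AlgebraicComplexity.FlipGraphStandardToStrassen
import HarnessLib

/-!
# The distance between the standard algorithm and Strassen's algorithm is `8` (KM 2023, §4)

Topic `Literature/Computability/AlgebraicComplexity`. Source: M. Kauers, J. Moosbauer, *Flip Graphs
for Matrix Multiplication*, ISSAC 2023 = arXiv:2212.01175 (KM), §4, on the `(2,2,2)`-flip graph of
rank at most `8` for `K = ℤ₂` (Fig. 1: "In the `(2,2,2)`-flip graph of rank at most `8`, this figure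
shows the component containing the standard algorithm. Flips are depicted by undirected edges and
reductions by directed edges."): "The component also contains Strassen's algorithm. The distance
between the standard algorithm and Strassen's algorithm is `8`, a path is highlighted in the
figure." The companion file `FlipGraphStandardToStrassen.lean` types the UPPER bound (an explicit
walk of `7` flips and one reduction); this file types the LOWER bound and hence the printed
equality. Everything is PROVED (a kernel-replayed certificate, `FlipGraphStdStrassenBall.lean`,
checked by the verified checker of `FlipGraph222BallCert.lean`); no named facts.

## The argument (ours; KM obtained the number by computing the graph)

Vertices are the orbits of the schemes of `⟨2,2,2⟩` over `ℤ₂` under KM's symmetry group `G`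
(`orbitSetoidKM`), edges are KM's `E₁ ∪ E₂` (flips and reductions, `flipGraphKM`, Def. 8), and the
graph "of rank at most `8`" keeps the orbits of rank `≤ 8` (`orbitRankKM`). A breadth-first search
from the standard algorithm using FLIPS ONLY finds `257` orbits at flip distance `≤ 6` (layer sizes
`1, 1, 9, 27, 75, 87, 57`), every one of them IRREDUCIBLE (KM Def. 2 fails in all six cases). The
kernel replays: (i) every flip of a representative of a layer `d ≤ 5` is `G`-equivalent to a
representative of a layer `≤ d + 1` (flips commute with `G`, KM §3, so one representative per orbit
suffices: `flipGraphKM_mk_iff`); (ii) all `257` representatives are irreducible. Consequently along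
any walk from the orbit of the standard algorithm through orbits of rank `≤ 8` — edges traversed in
EITHER direction — the first `6` steps stay inside the ball (a reduction out of an irreducible orbit
is impossible, a reduction INTO a rank-`8` orbit would come from rank `≥ 9`), and the `7`-th step
still ends at rank `8`; Strassen's orbit has rank `7`, so at least `8` steps are needed
(`kauersMoosbauer2023_std_strassen_eight_le`). With the walk of length `8` of
`FlipGraphStandardToStrassen.lean` the graph distance is exactly `8`
(`kauersMoosbauer2023_std_strassen_dist`, stated with Mathlib's `SimpleGraph.dist` on the undirected
simple graph underlying KM's flip graph of rank at most `8`).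

HONEST FRAMING: a statement about `⟨2,2,2⟩` over `ℤ₂` and KM's graph of rank at most `8` (as in
the printed sentence and Fig. 1); nothing is claimed about walks through schemes of rank `9`, about
other fields, or about KM's other printed numbers (`272` vertices, `1183` edges, diameter `12`).

## References

* M. Kauers, J. Moosbauer, *Flip Graphs for Matrix Multiplication*, ISSAC 2023, 381–388,
  doi:10.1145/3597066.3597120, arXiv:2212.01175: §4 and Fig. 1 ("The distance between the standard
  algorithm and Strassen's algorithm is 8"), Def. 2, Def. 4, Def. 8, §2–§3 (symmetry group,
  compatibility of flips and reductions with it). [KauersMoosbauer2022FlipGraphs]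
* V. Strassen, *Gaussian elimination is not optimal*, Numer. Math. 13 (1969) 354–356.
  [Strassen1969]
-/

set_option Elab.async false

namespace Literature.Computability.AlgebraicComplexity

open scoped BigOperators
open Multiset

namespace FlipGraph

/-! ## §1 The rank of an orbit -/

section OrbitRank

variable {K : Type*} [Field K] {n : ℕ}

/-- **The rank of an orbit** of KM's symmetry group on the schemes of `⟨n,n,n⟩` (equivalent schemes
have the same rank, so KM's "flip graph of rank at most `r`" (Def. 8 (2)) is a set of ORBITS).
[cite: KauersMoosbauer2022FlipGraphs, Def. 8] -/
def orbitRankKM (p : Quotient (orbitSetoidKM K n)) : ℕ :=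
  Quotient.liftOn p Scheme.rank fun a b h => by
    obtain ⟨φ, -, rfl⟩ := h
    exact (Scheme.rank_map φ a).symm

/-- The rank of the orbit of `x` is the rank of `x`. [cite: KauersMoosbauer2022FlipGraphs, Def. 8] -/
theorem orbitRankKM_mk (x : Scheme (matMulTensor K n n n)) :
    orbitRankKM (Quotient.mk (orbitSetoidKM K n) x) = x.rank := rfl

end OrbitRank

/-! ## §2 The ball of radius `6` around the standard algorithm (`⟨2,2,2⟩`, `ℤ₂`) -/

namespace StdBall222

open Cert222 StdToStrassenZ2

/-- **Representative `0` is the standard algorithm:** its code list presents `stdScheme ⟨2,2,2⟩`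
(kernel evaluation). [cite: KauersMoosbauer2022FlipGraphs, §4 ("the standard algorithm")] -/
theorem stdScheme_elts : (stdScheme (matMulTensor (ZMod 2) 2 2 2)).elts = elts3 (reps.getD 0 []) := by
  rw [← V0_eq_stdScheme]
  show StdToStrassenZ2.elts L0 = elts3 (reps.getD 0 [])
  decide +kernel

/-- **The ball predicate:** the orbit `p` is the orbit of a scheme whose elements are the image,
under an element of KM's group `G`, of the multiset presented by a representative of index
`< layerEnd d`. [cite: KauersMoosbauer2022FlipGraphs, §2 (equivalence = same orbit) and §4] -/
def InBall (d : ℕ) (p : Quotient (orbitSetoidKM (ZMod 2) 2)) : Prop :=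
  ∃ (x : Scheme (matMulTensor (ZMod 2) 2 2 2)) (φ : Symmetry (matMulTensor (ZMod 2) 2 2 2)) (i : ℕ),
    InSymmetryGroup φ ∧ p = Quotient.mk _ x ∧ i < layerEnd d ∧
      x.elts = (elts3 (reps.getD i [])).map φ.toLinearEquiv

/-- The orbit of the standard algorithm is in the ball of radius `0`.
[cite: KauersMoosbauer2022FlipGraphs, §4] -/
theorem inBall_zero : InBall 0 (Quotient.mk _ (stdScheme (matMulTensor (ZMod 2) 2 2 2))) := by
  refine ⟨stdScheme _, Symmetry.refl _, 0, InSymmetryGroup.refl, rfl, by decide, ?_⟩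
  rw [stdScheme_elts]
  simp [Symmetry.refl]

/-- A scheme presented (up to `G`) by a representative has rank `8`.
[cite: KauersMoosbauer2022FlipGraphs, §4 (flip graph "of rank at most 8")] -/
theorem rank_eq_eight {x : Scheme (matMulTensor (ZMod 2) 2 2 2)}
    {φ : Symmetry (matMulTensor (ZMod 2) 2 2 2)} {i : ℕ} (hi : i < 257)
    (hx : x.elts = (elts3 (reps.getD i [])).map φ.toLinearEquiv) : x.rank = 8 := by
  rw [Scheme.rank, hx, Multiset.card_map, elts3, Multiset.coe_card, List.length_map]
  exact reps_length i hi

/-- Orbits in the ball have rank `8`. [cite: KauersMoosbauer2022FlipGraphs, §4] -/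
theorem orbitRankKM_of_inBall {d : ℕ} {p : Quotient (orbitSetoidKM (ZMod 2) 2)} (hp : InBall d p) :
    orbitRankKM p = 8 := by
  obtain ⟨x, φ, i, -, rfl, hi, hx⟩ := hp
  exact rank_eq_eight (lt_of_lt_of_le hi (layerEnd_le d)) hx

/-- **The flip case of a step:** if `x'` is presented (up to `G`) by representative `i` of a layer
`d`, `y'` is a flip of `x'`, and `y = χ(y')` with `χ ∈ G`, then `y` has rank `8`, and for `d ≤ 5`
the orbit of `y` is in the ball of radius `d + 1` (certificate: `flip_step_of_repOK`).
[cite: KauersMoosbauer2022FlipGraphs, §3–§4] -/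
theorem flip_case {d i : ℕ} (hi : i < layerEnd d)
    {x' y' y : Scheme (matMulTensor (ZMod 2) 2 2 2)}
    {φ' χ : Symmetry (matMulTensor (ZMod 2) 2 2 2)} (hφ' : InSymmetryGroup φ') (hχ : InSymmetryGroup χ)
    (hx' : x'.elts = (elts3 (reps.getD i [])).map φ'.toLinearEquiv) (hflip : Flips x'.elts y'.elts)
    (hy : y = y'.map χ) :
    y.rank = 8 ∧ (d ≤ 5 → InBall (d + 1) (Quotient.mk _ y)) := by
  have hi' : i < 257 := lt_of_lt_of_le hi (layerEnd_le d)
  refine ⟨?_, fun hd5 => ?_⟩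
  · rw [hy, Scheme.rank_map, Scheme.rank, hflip.card_eq]
    exact rank_eq_eight hi' hx'
  · obtain ⟨hib, hble⟩ := bounds_le d hd5 i hi
    obtain ⟨t, ht, ψ, hψ, hy'⟩ := flip_step_of_repOK (repOK_all i hi') hib hφ' hx' hflip
    refine ⟨y, ψ.trans χ, t, hψ.trans hχ, rfl, lt_of_lt_of_le ht hble, ?_⟩
    rw [hy, Scheme.map_elts, hy', Multiset.map_map]
    rfl

/-- **One step next to the ball:** if `p` is in the ball of radius `d ≤ 6`, `p'` has rank `≤ 8`, and
`p, p'` are joined by an edge of KM's flip graph in either direction, then `p'` has rank exactly `8`,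
and for `d ≤ 5` it lies in the ball of radius `d + 1`. (Forward reductions are excluded by the
irreducibility of the representatives, backward reductions by the rank bound; flips by the matching
certificate.) [cite: KauersMoosbauer2022FlipGraphs, Def. 8, §3–§4] -/
theorem step {d : ℕ} {p p' : Quotient (orbitSetoidKM (ZMod 2) 2)} (hp : InBall d p)
    (he : flipGraphKM (ZMod 2) 2 p p' ∨ flipGraphKM (ZMod 2) 2 p' p) (hr : orbitRankKM p' ≤ 8) :
    orbitRankKM p' = 8 ∧ (d ≤ 5 → InBall (d + 1) p') := by
  obtain ⟨x, φ, i, hφ, rfl, hi, hx⟩ := hp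
  have hi' : i < 257 := lt_of_lt_of_le hi (layerEnd_le d)
  have hok := repOK_all i hi'
  induction p' using Quotient.ind with
  | _ y =>
    rw [orbitRankKM_mk] at hr ⊢
    rcases he with he | he
    · -- forward edge `[x] → [y]`: `x` itself has a flip or reduction equivalent to `y`
      obtain ⟨y', ⟨χ, hχ, hy'⟩, hadj⟩ := (flipGraphKM_mk_iff x y).mp he
      have hy : y = y'.map χ.symm := by rw [hy', Scheme.map_map_symm]
      rcases hadj with hflip | hred
      · exact flip_case hi hφ hχ.symm hx hflip hy
      · exact absurd hred (not_reduces_of_repOK hok hφ hx)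
    · -- backward edge `[y] → [x]`: `y` has a flip or reduction `x' = χ(x)`
      obtain ⟨x', ⟨χ, hχ, hx'⟩, hadj⟩ := (flipGraphKM_mk_iff y x).mp he
      have hx'e : x'.elts = (elts3 (reps.getD i [])).map (φ.trans χ).toLinearEquiv := by
        rw [hx', Scheme.map_elts, hx, Multiset.map_map]; rfl
      rcases hadj with hflip | hred
      · exact flip_case hi (hφ.trans hχ) InSymmetryGroup.refl hx'e hflip.symm
          (Scheme.map_refl y).symm
      · -- a reduction INTO the ball would start above rank `8`
        have hlt : x'.rank < y.rank := hred.card_lt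
        have h8 : x'.rank = 8 := rank_eq_eight hi' hx'e
        omega

/-- **KM §4, "The distance between the standard algorithm and Strassen's algorithm is `8`" — the
lower bound:** in KM's `(2,2,2)`-flip graph over `ℤ₂` on orbits (Def. 8), every walk from the orbit
of the standard algorithm to the orbit of Strassen's algorithm through orbits of rank at most `8`,
traversing flips and reductions in either direction, has length at least `8`.
[cite: KauersMoosbauer2022FlipGraphs, §4 (Fig. 1)] -/
theorem kauersMoosbauer2023_std_strassen_eight_le (k : ℕ)
    (q : ℕ → Quotient (orbitSetoidKM (ZMod 2) 2))
    (h0 : q 0 = Quotient.mk _ (stdScheme (matMulTensor (ZMod 2) 2 2 2)))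
    (hk : q k = Quotient.mk _ strassen)
    (hrank : ∀ j ≤ k, orbitRankKM (q j) ≤ 8)
    (hadj : ∀ j < k, flipGraphKM (ZMod 2) 2 (q j) (q (j + 1)) ∨ flipGraphKM (ZMod 2) 2 (q (j + 1)) (q j)) :
    8 ≤ k := by
  have ball : ∀ j, j ≤ k → j ≤ 6 → InBall j (q j) := by
    intro j
    induction j with
    | zero => intro _ _; rw [h0]; exact inBall_zero
    | succ j ih =>
      intro hjk hj6
      exact (step (ih (by omega) (by omega)) (hadj j (by omega)) (hrank (j + 1) hjk)).2 (by omega)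
  have hstr : orbitRankKM (q k) = 7 := by rw [hk, orbitRankKM_mk, rank_strassen]
  by_contra hlt
  rcases Nat.lt_or_ge k 7 with h7 | h7
  · have := orbitRankKM_of_inBall (ball k le_rfl (by omega))
    omega
  · have hk7 : k = 7 := by omega
    subst hk7
    have h8 : orbitRankKM (q 7) = 8 :=
      (step (ball 6 (by omega) le_rfl) (hadj 6 (by omega)) (hrank 7 le_rfl)).1
    omega

/-- Along a directed edge of KM's flip graph on orbits the rank does not increase (flips keep the
level, reductions lower it). [cite: KauersMoosbauer2022FlipGraphs, Def. 8 (remark following it)] -/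
theorem orbitRankKM_le_of_flipGraphKM {p p' : Quotient (orbitSetoidKM (ZMod 2) 2)}
    (h : flipGraphKM (ZMod 2) 2 p p') : orbitRankKM p' ≤ orbitRankKM p := by
  obtain ⟨x, y, rfl, rfl, hadj⟩ := h
  rw [orbitRankKM_mk, orbitRankKM_mk]
  exact hadj.rank_le

/-- **The directed reading** (Def. 8: `E₁ ∪ E₂` as directed edges; KM: "We have not introduced any
edges leading to higher levels"): every DIRECTED walk in KM's `(2,2,2)`-flip graph over `ℤ₂` from the
orbit of the standard algorithm to the orbit of Strassen's algorithm has length at least `8` — here no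
rank hypothesis is needed, the ranks along a directed walk from the standard algorithm being `≤ 8`
automatically. [cite: KauersMoosbauer2022FlipGraphs, §4 (Fig. 1) and Def. 8] -/
theorem kauersMoosbauer2023_std_strassen_eight_le_directed (k : ℕ)
    (q : ℕ → Quotient (orbitSetoidKM (ZMod 2) 2))
    (h0 : q 0 = Quotient.mk _ (stdScheme (matMulTensor (ZMod 2) 2 2 2)))
    (hk : q k = Quotient.mk _ strassen)
    (hadj : ∀ j < k, flipGraphKM (ZMod 2) 2 (q j) (q (j + 1))) : 8 ≤ k := by
  have hrank : ∀ j ≤ k, orbitRankKM (q j) ≤ 8 := by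
    intro j
    induction j with
    | zero => intro; rw [h0, orbitRankKM_mk, rank_stdScheme_matMulTensor]
    | succ j ih =>
      intro hj
      exact (orbitRankKM_le_of_flipGraphKM (hadj j (by omega))).trans (ih (by omega))
  exact kauersMoosbauer2023_std_strassen_eight_le k q h0 hk hrank fun j hj => Or.inl (hadj j hj)

end StdBall222

/-! ## §3 The distance in the flip graph of rank at most `8` -/

section Dist

open StdToStrassenZ2

/-- The vertex set of KM's `(2,2,2)`-flip graph of rank at most `8` over `ℤ₂`: the `G`-orbits of
schemes of rank `≤ 8`. [cite: KauersMoosbauer2022FlipGraphs, Def. 8 (2)] -/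
abbrev Vtx222LE8 : Type := {p : Quotient (orbitSetoidKM (ZMod 2) 2) // orbitRankKM p ≤ 8}

/-- **The undirected simple graph underlying KM's `(2,2,2)`-flip graph of rank at most `8` over
`ℤ₂`** (Fig. 1; KM draw flips as undirected edges and reductions as arrows — here every edge of
`E₁ ∪ E₂` may be traversed in either direction, and loops are discarded, as graph distance ignores
them). [cite: KauersMoosbauer2022FlipGraphs, §4 (Fig. 1) and Def. 8] -/
def flipGraph222LE8 : SimpleGraph Vtx222LE8 :=
  SimpleGraph.fromRel fun a b => flipGraphKM (ZMod 2) 2 a.1 b.1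

/-- The orbit of the standard algorithm as a vertex (rank `8`). [cite: KauersMoosbauer2022FlipGraphs, §4] -/
noncomputable def vtxStd : Vtx222LE8 :=
  ⟨Quotient.mk _ (stdScheme (matMulTensor (ZMod 2) 2 2 2)), by
    rw [orbitRankKM_mk, rank_stdScheme_matMulTensor]⟩

/-- The orbit of Strassen's algorithm as a vertex (rank `7`). [cite: KauersMoosbauer2022FlipGraphs, §4] -/
noncomputable def vtxStrassen : Vtx222LE8 :=
  ⟨Quotient.mk _ strassen, by rw [orbitRankKM_mk, rank_strassen]; norm_num⟩

/-- From a vertex sequence whose consecutive entries are equal or adjacent, a walk of at most that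
length (bookkeeping). [folklore] -/
private theorem exists_walk_length_le {V : Type*} (G : SimpleGraph V) :
    ∀ (n : ℕ) (f : ℕ → V), (∀ i < n, f i = f (i + 1) ∨ G.Adj (f i) (f (i + 1))) →
      ∃ p : G.Walk (f 0) (f n), p.length ≤ n := by
  intro n
  induction n with
  | zero => intro f _; exact ⟨SimpleGraph.Walk.nil, le_rfl⟩
  | succ n ih =>
    intro f hf
    obtain ⟨p, hp⟩ := ih (fun i => f (i + 1)) fun i hi => hf (i + 1) (by omega)
    rcases hf 0 (by omega) with h | h
    · exact ⟨p.copy h.symm rfl, by rw [SimpleGraph.Walk.length_copy]; omega⟩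
    · exact ⟨SimpleGraph.Walk.cons h p, by rw [SimpleGraph.Walk.length_cons]; omega⟩

/-- The same with prescribed endpoints. [folklore] -/
private theorem exists_walk_length_le' {V : Type*} (G : SimpleGraph V) (n : ℕ) (f : ℕ → V) (u v : V)
    (h0 : f 0 = u) (hn : f n = v) (hf : ∀ i < n, f i = f (i + 1) ∨ G.Adj (f i) (f (i + 1))) :
    ∃ p : G.Walk u v, p.length ≤ n := by
  subst h0; subst hn
  exact exists_walk_length_le G n f hf

/-- The walk of `FlipGraphStandardToStrassen.lean` gives distance `≤ 8` (and reachability).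
[cite: KauersMoosbauer2022FlipGraphs, §4 (Fig. 1)] -/
theorem exists_walk_std_strassen : ∃ p : flipGraph222LE8.Walk vtxStd vtxStrassen, p.length ≤ 8 := by
  -- the vertex sequence of the explicit walk, clamped after step `8`
  let f : ℕ → Vtx222LE8 := fun j =>
    if hj : j < 8 then ⟨Quotient.mk _ (V ⟨j, by omega⟩), by
        rw [orbitRankKM_mk]; exact (rank_V.1 ⟨j, hj⟩).le⟩
    else vtxStrassen
  have hf0 : f 0 = vtxStd := by
    apply Subtype.ext
    show Quotient.mk _ (V ⟨0, by omega⟩) = _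
    exact congrArg _ V0_eq_stdScheme
  have hf8 : f 8 = vtxStrassen := by simp [f]
  exact exists_walk_length_le' flipGraph222LE8 8 f _ _ hf0 hf8 (fun i hi => by
    by_cases heq : f i = f (i + 1)
    · exact Or.inl heq
    · refine Or.inr ((SimpleGraph.fromRel_adj _ _ _).mpr ⟨heq, Or.inl ?_⟩)
      -- the edge `V i → V (i+1)` of the explicit walk, on orbits
      have hi8 : i < 8 := hi
      have e1 : (f i).1 = Quotient.mk _ (V (⟨i, hi8⟩ : Fin 8).castSucc) := by
        simp only [f, dif_pos hi8]; rfl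
      have e2 : (f (i + 1)).1 = Quotient.mk _ (V (⟨i, hi8⟩ : Fin 8).succ) := by
        by_cases h7 : i + 1 < 8
        · simp only [f, dif_pos h7]; rfl
        · have hi7 : i = 7 := by omega
          subst hi7
          simp only [f, show ¬ (7 + 1 < 8) from by omega, dif_neg, not_false_eq_true, vtxStrassen]
          exact (Quotient.sound equiv_strassen : Quotient.mk (orbitSetoidKM (ZMod 2) 2) strassen = _)
      rw [e1, e2]
      exact ⟨_, _, rfl, rfl, adj_walk ⟨i, hi8⟩⟩)

/-- **KM §4: "The distance between the standard algorithm and Strassen's algorithm is `8`"** — in the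
undirected graph underlying KM's `(2,2,2)`-flip graph of rank at most `8` over `ℤ₂` (vertices: the
orbits of rank `≤ 8` under KM's symmetry group; edges: flips and reductions), the graph distance
between the orbit of the standard algorithm and the orbit of Strassen's algorithm is exactly `8`.
Upper bound: the explicit walk of `FlipGraphStandardToStrassen.lean`; lower bound: the
kernel-replayed ball certificate (`kauersMoosbauer2023_std_strassen_eight_le`).
[cite: KauersMoosbauer2022FlipGraphs, §4 (Fig. 1)] -/
theorem kauersMoosbauer2023_std_strassen_dist : flipGraph222LE8.dist vtxStd vtxStrassen = 8 := by
  obtain ⟨p₀, hp₀⟩ := exists_walk_std_strassen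
  refine le_antisymm ((SimpleGraph.dist_le p₀).trans hp₀) ?_
  -- a shortest walk, read as an orbit sequence, is subject to the lower bound
  obtain ⟨p, hp⟩ := p₀.reachable.exists_walk_length_eq_dist
  rw [← hp]
  refine StdBall222.kauersMoosbauer2023_std_strassen_eight_le p.length (fun j => (p.getVert j).1)
    (by rw [SimpleGraph.Walk.getVert_zero]; rfl)
    (by rw [SimpleGraph.Walk.getVert_of_length_le p le_rfl]; rfl)
    (fun j _ => (p.getVert j).2) fun j hj => ?_
  have hadj : (SimpleGraph.fromRel fun a b : Vtx222LE8 => flipGraphKM (ZMod 2) 2 a.1 b.1).Adj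
      (p.getVert j) (p.getVert (j + 1)) := p.adj_getVert_succ hj
  rw [SimpleGraph.fromRel_adj] at hadj
  exact hadj.2

end Dist

end FlipGraph

end Literature.Computability.AlgebraicComplexity
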